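import Mathlib
import HarnessLib

/-!
# Crux `FrobeniusLadder.FRationalResolution` (stmt-ResolutionOfSingularities-15317), line `redirect`,
# stub `stub_diagonalizableQuotientResolution` — THE LAURENT EMBEDDING of the monoid algebra `κ[P]` (`P ⊆ ℕⁿ`) and of its
# localization at a monomial: step 1 of the chart-ring structure theorem (β-chart) of MEMO-15317-leafhand2-g25 §3

The remaining generic brick for the per-class certificates of `…MonoidAlgebraModel.hasResolution_of_isolated_fixedPoints_of_monoidAlgebra_certificate`
(p843485) is the structure of the chart rings `κ[P][𝔳/χ^{e₀}] ⊆ κ[P][1/χ^{e₀}]`: they are monoid algebras of the cone monoids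
`P + ℕ(E − e₀) ⊆ ℤⁿ`. The proof (as for the Veronese charts, `…VeroneseChartRegular`) goes through the Laurent algebra `κ[ℤⁿ]`,
into which `κ[P]` and `κ[P][1/χ^{e₀}]` embed. This file provides these embeddings:

* ★ `exists_algHom_laurent` — an injective `κ`-algebra map `L : κ[P] → κ[ℤⁿ]` with `L(χᵖ) = x^p`;
* ★★ `exists_algHom_away_laurent` — for `e₀ ∈ P`, an injective `κ`-algebra map `Λ : κ[P][1/χ^{e₀}] → κ[ℤⁿ]` extending `L`, with
  `Λ(χᵖ/ (χ^{e₀})^k) = x^{p - k e₀}`.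

Honest label: elementary plumbing toward ONE leaf stub (no stub, crux or summit closed). No definitions, no named facts, no sorry.
[folklore; cite: CoxLittleSchenck2011, §1.1 (semigroup algebras inside the Laurent ring)]
-/

noncomputable section

-- single-problem summit: the doubled namespace component is forced
set_option linter.dupNamespace false

namespace Summit.ResolutionOfSingularities.ResolutionOfSingularities.Theorems.FRationalResolution.MonoidAlgebraLaurent

variable (κ : Type) [Field κ] {n : ℕ} (P : AddSubmonoid (Fin n →₀ ℕ))

/-- The exponent of `p ∈ ℕⁿ` in `ℤⁿ`. -/
local notation3 (prettyPrint := false) "toZ" =>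
  (Finsupp.mapRange.addMonoidHom (Nat.castAddMonoidHom ℤ) : (Fin n →₀ ℕ) →+ (Fin n →₀ ℤ))

omit [Field κ] in
/-- `ℕⁿ → ℤⁿ` is injective. [folklore] -/
theorem toZ_injective : Function.Injective (toZ : (Fin n →₀ ℕ) → (Fin n →₀ ℤ)) := by
  intro a b h
  ext i
  have := DFunLike.congr_fun h i
  simpa [Finsupp.mapRange.addMonoidHom_apply] using this

/-- A monomial of the Laurent algebra is a unit. [folklore] -/
theorem isUnit_single_laurent (m : Fin n →₀ ℤ) : IsUnit (AddMonoidAlgebra.single m (1 : κ) : AddMonoidAlgebra κ (Fin n →₀ ℤ)) := by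
  refine IsUnit.of_mul_eq_one (AddMonoidAlgebra.single (-m) (1 : κ)) ?_
  rw [AddMonoidAlgebra.single_mul_single, add_neg_cancel, mul_one, AddMonoidAlgebra.one_def]

/-- ★ **The Laurent embedding of `κ[P]`.** An injective `κ`-algebra map `κ[P] → κ[ℤⁿ]` with `χᵖ ↦ x^p`. [folklore] -/
theorem exists_algHom_laurent :
    ∃ L : AddMonoidAlgebra κ ↥P →ₐ[κ] AddMonoidAlgebra κ (Fin n →₀ ℤ),
      Function.Injective L ∧ ∀ (p : ↥P) (c : κ), L (AddMonoidAlgebra.single p c) = AddMonoidAlgebra.single (toZ (p : Fin n →₀ ℕ)) c := by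
  classical
  let ι : ↥P →+ (Fin n →₀ ℤ) := (toZ).comp P.subtype
  have hι : Function.Injective ι := toZ_injective.comp Subtype.val_injective
  refine ⟨AddMonoidAlgebra.mapDomainAlgHom κ κ ι, ?_, ?_⟩
  · intro x y hxy
    rw [AddMonoidAlgebra.mapDomainAlgHom_apply, AddMonoidAlgebra.mapDomainAlgHom_apply] at hxy
    exact AddMonoidAlgebra.mapDomain_injective hι hxy
  · intro p c
    rw [AddMonoidAlgebra.mapDomainAlgHom_apply, AddMonoidAlgebra.mapDomain_single]
    rfl

/-- ★★ **The Laurent embedding of `κ[P][1/χ^{e₀}]`.** For `e₀ ∈ P` there are injective `κ`-algebra maps `L : κ[P] → κ[ℤⁿ]` and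
`Λ : κ[P][1/χ^{e₀}] → κ[ℤⁿ]` with `Λ ∘ (κ[P] → κ[P][1/χ^{e₀}]) = L`, `L(χᵖ) = x^p`, and `Λ((χ^{e₀})⁻¹) = x^{-e₀}`. [folklore] -/
theorem exists_algHom_away_laurent (e₀ : ↥P) :
    ∃ (L : AddMonoidAlgebra κ ↥P →ₐ[κ] AddMonoidAlgebra κ (Fin n →₀ ℤ))
      (Λ : Localization.Away (AddMonoidAlgebra.single e₀ (1 : κ)) →ₐ[κ] AddMonoidAlgebra κ (Fin n →₀ ℤ)),
      Function.Injective L ∧ Function.Injective Λ ∧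
      (∀ (p : ↥P) (c : κ), L (AddMonoidAlgebra.single p c) = AddMonoidAlgebra.single (toZ (p : Fin n →₀ ℕ)) c) ∧
      (∀ a, Λ (algebraMap _ _ a) = L a) ∧
      Λ (IsLocalization.Away.invSelf (AddMonoidAlgebra.single e₀ (1 : κ))) = AddMonoidAlgebra.single (-toZ (e₀ : Fin n →₀ ℕ)) 1 := by
  obtain ⟨L, hLinj, hL⟩ := exists_algHom_laurent κ P
  set y : AddMonoidAlgebra κ ↥P := AddMonoidAlgebra.single e₀ (1 : κ) with hy
  have hLy : L y = AddMonoidAlgebra.single (toZ (e₀ : Fin n →₀ ℕ)) 1 := hL e₀ 1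
  have hunit : IsUnit (L y) := by rw [hLy]; exact isUnit_single_laurent κ _
  let Λ : Localization.Away y →ₐ[κ] AddMonoidAlgebra κ (Fin n →₀ ℤ) := IsLocalization.Away.liftAlgHom y hunit
  have hΛ : ∀ a, Λ (algebraMap _ _ a) = L a := fun a => by
    change IsLocalization.Away.lift y hunit (algebraMap _ _ a) = L a
    exact IsLocalization.Away.lift_eq y hunit a
  refine ⟨L, Λ, hLinj, ?_, hL, hΛ, ?_⟩
  · -- injectivity of the lift
    have key : Function.Injective Λ.toRingHom := by
      rw [IsLocalization.injective_iff_map_algebraMap_eq (Submonoid.powers y)]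
      intro a b
      change _ ↔ Λ (algebraMap _ _ a) = Λ (algebraMap _ _ b)
      rw [hΛ, hΛ]
      constructor
      · intro hab
        obtain ⟨⟨_, k, rfl⟩, hk⟩ := (IsLocalization.eq_iff_exists (Submonoid.powers y) _).mp hab
        have h1 : L (y ^ k) * L a = L (y ^ k) * L b := by
          rw [← map_mul, ← map_mul]
          exact congrArg L hk
        have hu : IsUnit (L (y ^ k)) := by rw [map_pow]; exact hunit.pow k
        exact hu.mul_left_cancel h1
      · intro hab
        rw [hLinj hab]
    exact key
  · -- the inverse of `χ^{e₀}`
    have h1 : Λ (algebraMap _ _ y) * Λ (IsLocalization.Away.invSelf y) = 1 := by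
      rw [← map_mul, IsLocalization.Away.mul_invSelf, map_one]
    rw [hΛ, hLy] at h1
    have h2 : AddMonoidAlgebra.single (toZ (e₀ : Fin n →₀ ℕ)) (1 : κ) * AddMonoidAlgebra.single (-toZ (e₀ : Fin n →₀ ℕ)) 1 = 1 := by
      rw [AddMonoidAlgebra.single_mul_single, add_neg_cancel, mul_one, AddMonoidAlgebra.one_def]
    calc Λ (IsLocalization.Away.invSelf y)
        = (AddMonoidAlgebra.single (-toZ (e₀ : Fin n →₀ ℕ)) 1 * AddMonoidAlgebra.single (toZ (e₀ : Fin n →₀ ℕ)) (1 : κ)) *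
            Λ (IsLocalization.Away.invSelf y) := by rw [mul_comm (AddMonoidAlgebra.single _ _), h2, one_mul]
      _ = AddMonoidAlgebra.single (-toZ (e₀ : Fin n →₀ ℕ)) 1 := by rw [mul_assoc, h1, mul_one]

end Summit.ResolutionOfSingularities.ResolutionOfSingularities.Theorems.FRationalResolution.MonoidAlgebraLaurent

end
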